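import Summits.ABC.IUTFork.Cor312RegimeVerbatimPrVolExactDyadicSplit
import Summits.ABC.IUTFork.Cor312RegimeVerbatimPrVolExactPositive
import HarnessLib

/-!
# [IUTchIII] Cor. 3.12 — the regime decomposition at the print-normalised sharp setting of record, X: over `ℚ` the typed
# Statement FAILS at EVERY sharp datum of positive `q`-depth — the (G3) countermodel WITHOUT a depth threshold

PROOF-ONLY support piece of the abc-iut cell (Cor. 3.12 cone, D-0067; seat abc-iut-w4-d107, gen 5; part 24 of the
`Cor312NegLogThetaUpperPrVol*` / `Cor312RegimeVerbatimPrVol*` chain, sequel of part 22 `…ExactDyadicSplit`). TAKES NO SIDE on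
[IUTchIII] Cor. 3.12; theorems only, 0 `def`s, no new `Prop` fact, no instance.

This seat's gen-4 countermodel at the genuine glue (`settingPrVolSharp_not_statement_of_sharp_deep`, p433912;
`exists_sharp_deep_ideles_not_statement`) needed the `q`-ideles to be DEEPER than an existential constant `C(X, logv)` at a prime of
bad mass one. Part 22 showed that over `ℚ` the shift is `0` (`statement_settingPrVolSharp_iff_rat`: Statement ⟺ Qside ≤ Θside).
THIS FILE reads it off for the sharp-realising exponent shape of [IUTchIII] Rmk. 3.1.1 (`q^{j²}` at the label `j`; Dupuy–Hilado
§3.4: `P_{Θ,j} = j²·P_q`):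

* **`not_statement_settingPrVolSharp_rat_of_sharp_pos_depth`** — over `ℚ`, for a pilot datum whose places of `S` lie over a
  finite set `U` of odd primes, `q`-exponents `m_q(p) ≥ 0` and Θ-exponents `(i+1)²·m_q(p)` over `U`, with `m_q(p) > 0` at SOME
  `p ∈ U`: `¬ Statement` — at EVERY positive depth, no threshold (`Θside = PN_i((i+1)²·Q₀) < Q₀ = Qside` since `Q₀ < 0`, `l⋆ ≥ 2`).
So at the cell's `ℚ`-beds the typed [IUTchIII] Cor. 3.12 at the genuine sharp setting holds at the trivial `q`-pilot (part 22,
`Qside = Θside = 0`) and fails at every sharp datum with a nontrivial `q`-pilot. HONEST SCOPE as in parts 7–23: (Ind2) as typed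
at the real setting; sharp (Ind3) reading; trivial archimedean container; free ideles; `ℚ` is NOT the base field of any initial
Θ-datum (`√−1 ∉ ℚ`); nothing here asserts or denies [IUTchIII] Cor. 3.12 for initial Θ-data. typed ≠ proved; instantiated ≠
endorsed. [claim: Mochizuki2012, status: disputed] [cite: Mochizuki2012, IUTchIII Rmk. 3.1.1 (ii) p. 94]
[cite: DupuyHilado2025, §3.4, §3.6, §3.9, §4.7] [cite: ScholzeStix2018, §2.2 pp. 9–10]
-/

noncomputable section

open Set Function NumberField IsDedekindDomain
open scoped Pointwise

namespace Summit.ABC.IUTFork.Thm311.Real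

open Cor312 Cor312.Setting Cor312Vol Literature.IUT.LogThetaLattice Literature.IUT.LogVolume

variable (X : PilotData ℚ) {logv : PadicLogs ℚ} (hlog : LogvAnalytic logv)
  (M : Type) [Field M] [NumberField M]
  (archPk : ∀ (j : (thetaIndex X).Label) (vQ : (thetaIndex X).VQ), Set ((logShellsDH X logv).Packet j vQ))
  (archSub : ∀ (j : (thetaIndex X).Label) (v : (thetaIndex X).V),
    Set ((logShellsDH X logv).Packet j ((thetaIndex X).over v)))
  (Ψ : ℤ → ∀ v : (thetaIndex X).V, v ∈ (thetaIndex X).Vbad → Set ((logShellsDH X logv).StarPacket v))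
  (act : ℤ → ∀ v : (thetaIndex X).V, v ∈ (thetaIndex X).Vbad →
    (logShellsDH X logv).StarPacket v → Module.End ℚ ((logShellsDH X logv).StarPacket v))
  (Mmod : ℤ → ∀ j : (thetaIndex X).LabelStar, Set ((logShellsDH X logv).GlobalPacket j.1))
  (region : ℤ → ∀ j : (thetaIndex X).LabelStar, FinDivisor M → ∀ vQ : (thetaIndex X).VQ,
    Set ((logShellsDH X logv).Packet j.1 vQ))
  (n : ℤ) {HT : Type} {LogLink : HT → HT → Type} {IsFull : ∀ {s t : HT}, LogLink s t → Prop}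
  (lat : LGPGaussianLogThetaLattice LogLink IsFull)
  {Frd : Type} {IsoF : Frd → Frd → Type} {Ob : Frd → Type} {realify : Frd → Frd} {Strip : Type}
  {IsoS : Strip → Strip → Type} {Mv : ∀ v : (thetaIndex X).V, v ∈ (thetaIndex X).Vbad → Type}
  [∀ v h, Monoid (Mv v h)]
  (sig : GlobalLGPFrobenioidSignature (thetaIndex X).lstar (thetaIndex X).V (· ∈ (thetaIndex X).Vbad)
    Frd IsoF Ob realify Strip IsoS Mv)
  (split : SplittingMonoids Mv) {ObΔ : Type} {N : ∀ v : (thetaIndex X).V, v ∈ (thetaIndex X).Vbad → Type}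
  [∀ v h, Monoid (N v h)] (qData : QPilotData ObΔ N)
  (tq : ∀ (pp : Nat.Primes) (x : (thetaIndex X).Fibre (.inr pp)), haveI : Fact (pp : ℕ).Prime := ⟨pp.2⟩; kOf X pp.1 x)
  (t : ∀ (pp : Nat.Primes) (_ : Fin X.lstar) (x : (thetaIndex X).Fibre (.inr pp)),
    haveI : Fact (pp : ℕ).Prime := ⟨pp.2⟩; kOf X pp.1 x)

/-- The inner packet sum of a summand that does not read the packet is that summand (the probability weights sum to `1`,
abc-iut-c312-1/c312-5 `sum_weightPr_presAt`). [cite: DupuyHilado2025, §3.6] -/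
theorem sum_weightPr_mul_const (i : Fin (thetaIndex X).lstar) (pp : Nat.Primes) (c : ℝ) :
    haveI : Fact (pp : ℕ).Prime := ⟨pp.2⟩
    ∑ e : (presAt X hlog pp).toLocalPieces.E (Setting.labelSucc i), weightPr X pp.1 (Setting.labelSucc i) e * c = c := by
  haveI : Fact (pp : ℕ).Prime := ⟨pp.2⟩
  rw [← Finset.sum_mul, sum_weightPr_presAt, one_mul]

/-- **OVER `ℚ` THE TYPED COR. 3.12 FAILS AT EVERY SHARP DATUM OF POSITIVE `q`-DEPTH — no threshold.** For a pilot datum over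
`ℚ` whose places of `S` lie over a finite set `U` of odd primes, `q`-ideles with exponents `m_q(p) ≥ 0` over `U` and Θ-ideles with
the sharp-realising exponents `(i+1)²·m_q(p)` ([IUTchIII] Rmk. 3.1.1: `q^{j²}` at the label `j = i+1`), all non-zero and units off
`S`: if `m_q(p) > 0` for some `p ∈ U`, then `¬ Statement` at `Real.settingPrVolSharp`. The gen-4 countermodel
(`settingPrVolSharp_not_statement_of_sharp_deep`) without its depth threshold. [claim: Mochizuki2012, status: disputed]
[cite: Mochizuki2012, IUTchIII Rmk. 3.1.1 (ii) p. 94] [cite: DupuyHilado2025, §3.4, §3.9, §4.7] -/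
theorem not_statement_settingPrVolSharp_rat_of_sharp_pos_depth (ht0 : ∀ pp i x, t pp i x ≠ 0)
    (ht1 : ∀ (pp : Nat.Primes) (i : Fin X.lstar) (x : (thetaIndex X).Fibre (.inr pp)),
      haveI : Fact (pp : ℕ).Prime := ⟨pp.2⟩; placeOf X pp.1 x ∉ X.S → ‖t pp i x‖ = 1)
    (htq0 : ∀ pp x, tq pp x ≠ 0)
    (htq1 : ∀ (pp : Nat.Primes) (x : (thetaIndex X).Fibre (.inr pp)),
      haveI : Fact (pp : ℕ).Prime := ⟨pp.2⟩; placeOf X pp.1 x ∉ X.S → ‖tq pp x‖ = 1)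
    (U : Finset Nat.Primes)
    (hU : ∀ (pp : Nat.Primes) (x : (thetaIndex X).Fibre (.inr pp)),
      haveI : Fact (pp : ℕ).Prime := ⟨pp.2⟩; placeOf X pp.1 x ∈ X.S → pp ∈ U)
    (hU2 : ∀ pp ∈ U, 2 < (pp : ℕ)) (mq : Nat.Primes → ℤ) (hmq0 : ∀ pp ∈ U, 0 ≤ mq pp)
    (hmq : ∀ (pp : Nat.Primes), pp ∈ U → ∀ (x : (thetaIndex X).Fibre (.inr pp)),
      haveI : Fact (pp : ℕ).Prime := ⟨pp.2⟩; ‖tq pp x‖ = ‖((pp : ℕ) : ℚ_[pp]) ^ mq pp‖)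
    (hm : ∀ (pp : Nat.Primes), pp ∈ U → ∀ (i : Fin (thetaIndex X).lstar) (x : (thetaIndex X).Fibre (.inr pp)),
      haveI : Fact (pp : ℕ).Prime := ⟨pp.2⟩; ‖t pp i x‖ = ‖((pp : ℕ) : ℚ_[pp]) ^ ((((i : ℕ) : ℤ) + 1) ^ 2 * mq pp)‖)
    (hpos : ∃ pp ∈ U, 0 < mq pp) :
    ¬ (settingPrVolSharp X hlog M archPk archSub Ψ act Mmod region n lat sig split qData tq t htq0 htq1).Statement := by
  have hl : 0 < (thetaIndex X).lstar := lt_of_lt_of_le two_pos (thetaIndex X).two_le_lstar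
  rw [statement_settingPrVolSharp_iff_rat X hlog M archPk archSub Ψ act Mmod region n lat sig split qData tq t ht0 ht1 htq0 htq1 U
    hU hU2 (fun pp i _ => (((i : ℕ) : ℤ) + 1) ^ 2 * mq pp) hm (fun pp _ => mq pp) hmq, not_le]
  -- the `q`-side number `Q₀ := Σ_{p∈U} −m_q(p)·log p < 0`
  set Q₀ : ℝ := ∑ pp ∈ U, (-((mq pp : ℤ) : ℝ) * Real.log (pp : ℕ)) with hQ₀
  have hQ₀neg : Q₀ < 0 := by
    obtain ⟨p₀, hp₀U, hp₀⟩ := hpos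
    have hle : ∀ pp ∈ U, (-((mq pp : ℤ) : ℝ) * Real.log (pp : ℕ)) ≤ 0 := fun pp hpp =>
      mul_nonpos_of_nonpos_of_nonneg (neg_nonpos.mpr (by exact_mod_cast hmq0 pp hpp))
        (Real.log_nonneg (by exact_mod_cast pp.2.one_lt.le))
    have hlt : (-((mq p₀ : ℤ) : ℝ) * Real.log (p₀ : ℕ)) < 0 :=
      mul_neg_of_neg_of_pos (neg_neg_of_pos (by exact_mod_cast hp₀)) (Real.log_pos (by exact_mod_cast p₀.2.one_lt))
    have h := Finset.sum_lt_sum hle ⟨p₀, hp₀U, hlt⟩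
    rw [Finset.sum_const_zero] at h
    exact h
  -- the `q`-side is `Q₀` at every label, the Θ-side is `(i+1)²·Q₀`; compare through the procession normalisation
  have hle : ∀ i : Fin (thetaIndex X).lstar, (((i : ℕ) : ℝ) + 1) ^ 2 * Q₀ ≤ Q₀ := fun i =>
    mul_le_of_one_le_left hQ₀neg.le (one_le_pow₀ (by have := (i : ℕ).cast_nonneg (α := ℝ); linarith))
  have hlt : ((((⟨1, (thetaIndex X).two_le_lstar⟩ : Fin (thetaIndex X).lstar) : ℕ) : ℝ) + 1) ^ 2 * Q₀ < Q₀ := by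
    have h4 : ((((⟨1, (thetaIndex X).two_le_lstar⟩ : Fin (thetaIndex X).lstar) : ℕ) : ℝ) + 1) ^ 2 = 4 := by norm_num
    rw [h4]
    linarith
  have h := processionNormalized_lt_of_le_of_lt hl (f := fun i : Fin (thetaIndex X).lstar => (((i : ℕ) : ℝ) + 1) ^ 2 * Q₀)
    (g := fun _ => Q₀) hle hlt
  refine lt_of_eq_of_lt ?_ (lt_of_lt_of_eq h ?_)
  · -- the Θ-side: `inf'` of the constant exponent, weights summing to `1`
    refine congrArg processionNormalized (funext fun i => ?_)
    rw [hQ₀, Finset.mul_sum]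
    refine Finset.sum_congr rfl fun pp _ => ?_
    haveI : Fact (pp : ℕ).Prime := ⟨pp.2⟩
    simp only [Finset.inf'_const]
    rw [sum_weightPr_mul_const]
    push_cast
    ring
  · -- the `q`-side: weights summing to `1`
    refine congrArg processionNormalized (funext fun i => ?_)
    rw [hQ₀]
    exact Finset.sum_congr rfl fun pp _ => (sum_weightPr_mul_const X hlog i pp _).symm

end Summit.ABC.IUTFork.Thm311.Real

end
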